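import Literature.Geometry.Lorentzian.KerrDeSitterHeunForm
import Summits.Ventures.KdS.RouteWDoublyResonantVieta
import HarnessLib

/-!
# Venture KdS — the doubly-resonant candidates, III: the dictionary from the tree's Heun data
# (Hatsuda gauge) to T10's root functional `Φ`

HONEST FRAMING (venture `Summits/Ventures/KdS`, cell `pub-kds`; optional kernel object of the
Monday S3 seat, continuing `RouteWDoublyResonantComparison` (T10 Lemma A) and
`RouteWDoublyResonantVieta` (T10 Lemma B)). The cell's note T10 (`lit/Q3PRIME-CASES.md`, REF #445)
proves on paper that every doubly-resonant POLYNOMIAL candidate of STRUCTURE §8 Q3′ has `Re λ̄ < 0`;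
its §5 lists as NOT kernel-checked "the glue: that (3.1) = heunV solved for λ" against the tree's
Heun conventions. This file types that glue against the tree's OWN `heunV`, `heunGamma`,
`heunDelta`, `heunEps`, `horizonB`, `surfaceGravity`, `lambdaBar`: at `m = 0`, `ω = iy` (`y` real)
* the horizon exponents are real, `2B(r₊) = −y/κ₊`, `2B(r_c) = y/κ_c`, `2B(r_n) = −(y/κ_c)·b_n`,
  hence on a doubly-resonant stratum `y = (s−1−i₀)κ₊ = (j−s)κ_c`: `γ = 2 + i₀`, `δ = j + 1`,
  `ε = s + 1 − u·b_n` (`heunGamma_of_resonance`, `heunDelta_of_resonance`, `heunEps_of_resonance`);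
* `heunV` is AFFINE in `λ` with the real slope `c₁ = 3/(Λ(r₋−r_n)(r₊−r_c)) < 0`, `c₁·T₁ = 1`, and a
  REAL intercept (`heunV_imag`, `cSlope_mul_tOne`, `cSlope_neg`) — T10 §1;
* T10 §2 COROLLARY / (3.1): for every `λ`,
  `Re λ̄ = T₁·Re heunV(λ) + s(1−α) − (1+s)(1+2s)T₂ + (1+2s)(y/κ₊)T₃ + Ξ²a²y²` (`re_lambdaBar_eq`),
  `T₁, T₂, T₃` the root functionals of `RouteWDoublyResonantVieta` at the tree's roots
  `(r_n, r₋, r₊, r_c)` (`tThree_eq` is the rewriting `2Ξκ₊(r₊r₋+a²)/(r₊−r₋) = T₃`);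
* (3.1) → (4.1): the resonance substitution turns that right-hand side, at `heunV(λ) = q′ + pγ`,
  into `T₁·Re q′ + Φ` with `Φ = phiDR` VERBATIM (`phi31_eq_phiDR`); the tree's roots satisfy the
  Vieta bundle `IsOrderedRootData Λ a² M r_n r₋ r₊ r_c` for `a ≠ 0` (`isOrderedRootData_kds`);
* ★ `re_lambdaBar_neg_of_re_nonneg`: on subextremal Kerr–de Sitter with `a ≠ 0`, at `m = 0`,
  `ω = iy`, `y = uκ_c = (s−1−i₀)κ₊`, `u > 0`, `i₀ ≥ 0`, every `λ` with
  `heunV(λ) = q′ + (u b_n − s)(2 + i₀)` and `0 ≤ Re q′` has `Re λ̄ < 0`.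
With Lemma A (`tridiagonal_eigenvalue_re_nonneg`) this is T10's theorem for every candidate whose
transformed accessory parameter `q′` is an eigenvalue of a real tridiagonal matrix with negative
off-diagonal products and nonnegative diagonal (the companion file `RouteWDoublyResonantTruncation`
records T10's matrix (1.1) in that class). STILL NOT typed (T10 §5, unchanged): that the F-homotopy
`y = (z_r − x)^{1−ε}u` and the polynomial truncation of Heun's equation at `x = 0` produce exactly
(1.1) — generic Heun bookkeeping, not Kerr–de Sitter input. Nothing here is a statement about
`NonExtremeStrata` itself, H3, or the Final State Conjecture. 0 cited facts, no `sorry`.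
-/

noncomputable section

open Complex

namespace Summit.Ventures.KdS.RouteW.DoublyResonant

open Literature.Geometry.Lorentzian Literature.Geometry.Lorentzian.KerrDeSitter

/-! ### §1. Horizon exponents at `m = 0`, `ω = iy` -/

/-- `K(r) = iy(r² + a²)` at `m = 0`, `ω = iy`. -/
theorem radialK_imag (a y r : ℝ) :
    radialK a (I * y) 0 r = I * ((y * (r ^ 2 + a ^ 2) : ℝ) : ℂ) := by
  unfold radialK
  push_cast
  ring

/-- `B(r_h) = −Ξy(r_h² + a²)/Δ_r′(r_h)` is REAL at `m = 0`, `ω = iy` (T10 §1). -/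
theorem horizonB_imag (M a Λ y rh : ℝ) :
    horizonB M a Λ (I * y) 0 rh =
      ((-(xi a Λ * y * (rh ^ 2 + a ^ 2) / deltaDeriv M a Λ rh) : ℝ) : ℂ) := by
  unfold horizonB
  rw [radialK_imag]
  push_cast
  linear_combination
    ((xi a Λ : ℂ) * (y : ℂ) * ((rh : ℂ) ^ 2 + (a : ℂ) ^ 2) / (deltaDeriv M a Λ rh : ℂ)) * I_mul_I

/-- `2B(r₊) = −y/κ₊` at `m = 0`, `ω = iy` (T10 §1; `Δ_r′(r₊) > 0`). -/
theorem two_horizonB_rPlus {M a Λ : ℝ} (hsub : IsSubextremal M a Λ) (y : ℝ) :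
    2 * horizonB M a Λ (I * y) 0 (rPlus M a Λ) =
      ((-(y / surfaceGravity M a Λ (rPlus M a Λ))) : ℝ) := by
  have hd := deltaDeriv_rPlus_pos hsub
  have hX : 0 < xi a Λ := by unfold xi; obtain ⟨-, hΛ, -⟩ := hsub; positivity
  have hR : 0 < rPlus M a Λ ^ 2 + a ^ 2 := by
    have h0 := rMinus_nonneg M a Λ
    obtain ⟨-, -, h01, -⟩ := hsub
    have : 0 < rPlus M a Λ := by linarith
    positivity
  rw [horizonB_imag]
  unfold surfaceGravity
  rw [abs_of_pos hd]
  push_cast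
  field_simp

/-- `2B(r_c) = +y/κ_c` at `m = 0`, `ω = iy` (T10 §1; `Δ_r′(r_c) < 0`). -/
theorem two_horizonB_rCosmo {M a Λ : ℝ} (hsub : IsSubextremal M a Λ) (y : ℝ) :
    2 * horizonB M a Λ (I * y) 0 (rCosmo M a Λ) =
      ((y / surfaceGravity M a Λ (rCosmo M a Λ)) : ℝ) := by
  have hd := deltaDeriv_rCosmo_neg hsub
  have hX : 0 < xi a Λ := by unfold xi; obtain ⟨-, hΛ, -⟩ := hsub; positivity
  have hR : 0 < rCosmo M a Λ ^ 2 + a ^ 2 := by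
    have h0 := rMinus_nonneg M a Λ
    obtain ⟨-, -, h01, h12, -⟩ := hsub
    have : 0 < rCosmo M a Λ := by linarith
    positivity
  rw [horizonB_imag]
  unfold surfaceGravity
  rw [abs_of_neg hd]
  push_cast
  field_simp


/-- `Δ_r′(r_n) > 0` at the negative root (three negative factors in `deltaDeriv_at_rNeg`). -/
theorem deltaDeriv_rNeg_pos {M a Λ : ℝ} (hsub : IsSubextremal M a Λ) :
    0 < deltaDeriv M a Λ (rNeg M a Λ) := by
  rw [deltaDeriv_at_rNeg hsub]
  have h0 := rMinus_nonneg M a Λ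
  obtain ⟨-, hΛ, h01, h12, -⟩ := hsub
  have e : -(Λ / 3) * ((rNeg M a Λ - rMinus M a Λ) * (rNeg M a Λ - rPlus M a Λ) *
      (rNeg M a Λ - rCosmo M a Λ)) = Λ / 3 * ((rMinus M a Λ - rNeg M a Λ) *
        (rPlus M a Λ - rNeg M a Λ) * (rCosmo M a Λ - rNeg M a Λ)) := by ring
  rw [e]
  have h1 : 0 < rMinus M a Λ - rNeg M a Λ := by unfold rNeg; linarith
  have h2 : 0 < rPlus M a Λ - rNeg M a Λ := by unfold rNeg; linarith
  have h3 : 0 < rCosmo M a Λ - rNeg M a Λ := by unfold rNeg; linarith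
  positivity

/-- T10's `b_n := 2Ξκ_c(r_n² + a²)/Δ_r′(r_n)` (the ratio `−2B(r_n)/(y/κ_c)` at `m = 0`,
`ω = iy`). -/
def bNeg (M a Λ : ℝ) : ℝ :=
  2 * xi a Λ * surfaceGravity M a Λ (rCosmo M a Λ) * (rNeg M a Λ ^ 2 + a ^ 2) /
    deltaDeriv M a Λ (rNeg M a Λ)

/-- `b_n > 0` on subextremal Kerr–de Sitter (T10 §1). -/
theorem bNeg_pos {M a Λ : ℝ} (hsub : IsSubextremal M a Λ) : 0 < bNeg M a Λ := by
  have hd := deltaDeriv_rNeg_pos hsub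
  have hκ := surfaceGravity_rCosmo_pos hsub
  have hX : 0 < xi a Λ := by unfold xi; obtain ⟨-, hΛ, -⟩ := hsub; positivity
  have hn : rNeg M a Λ < 0 := by
    have h0 := rMinus_nonneg M a Λ
    obtain ⟨-, -, h01, h12, -⟩ := hsub
    unfold rNeg; linarith
  have hR : 0 < rNeg M a Λ ^ 2 + a ^ 2 := add_pos_of_pos_of_nonneg (sq_pos_of_neg hn) (sq_nonneg a)
  unfold bNeg
  exact div_pos (mul_pos (mul_pos (mul_pos two_pos hX) hκ) hR) hd

/-- `2B(r_n) = −(y/κ_c)·b_n` at `m = 0`, `ω = iy` (T10 §1). -/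
theorem two_horizonB_rNeg {M a Λ : ℝ} (hsub : IsSubextremal M a Λ) (y : ℝ) :
    2 * horizonB M a Λ (I * y) 0 (rNeg M a Λ) =
      ((-(y / surfaceGravity M a Λ (rCosmo M a Λ)) * bNeg M a Λ : ℝ) : ℂ) := by
  have hκ : (surfaceGravity M a Λ (rCosmo M a Λ) : ℂ) ≠ 0 := by
    exact_mod_cast (surfaceGravity_rCosmo_pos hsub).ne'
  have hd : (deltaDeriv M a Λ (rNeg M a Λ) : ℂ) ≠ 0 := by
    exact_mod_cast (deltaDeriv_rNeg_pos hsub).ne'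
  rw [horizonB_imag]
  unfold bNeg
  push_cast
  field_simp

/-- **`γ = 2 + i₀` on the event-horizon lattice** `y = (s − 1 − i₀)κ₊` (T10 §1). -/
theorem heunGamma_of_resonance {M a Λ : ℝ} (hsub : IsSubextremal M a Λ) {s y i₀ : ℝ}
    (hy : y = (s - 1 - i₀) * surfaceGravity M a Λ (rPlus M a Λ)) :
    heunGamma M a Λ s (I * y) 0 = ((2 + i₀ : ℝ) : ℂ) := by
  have hκ := (surfaceGravity_rPlus_pos hsub).ne'
  unfold heunGamma
  rw [two_horizonB_rPlus hsub, hy, mul_div_cancel_right₀ _ hκ]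
  push_cast
  ring

/-- **`δ = j + 1` on the cosmological lattice** `y = (j − s)κ_c` (T10 §1). -/
theorem heunDelta_of_resonance {M a Λ : ℝ} (hsub : IsSubextremal M a Λ) {s y j : ℝ}
    (hy : y = (j - s) * surfaceGravity M a Λ (rCosmo M a Λ)) :
    heunDelta M a Λ s (I * y) 0 = ((j + 1 : ℝ) : ℂ) := by
  have hκ := (surfaceGravity_rCosmo_pos hsub).ne'
  unfold heunDelta
  rw [two_horizonB_rCosmo hsub, hy, mul_div_cancel_right₀ _ hκ]
  push_cast
  ring

/-- **`ε = s + 1 − u·b_n`** when `y = uκ_c` (T10 §1). -/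
theorem heunEps_of_resonance {M a Λ : ℝ} (hsub : IsSubextremal M a Λ) {s y u : ℝ}
    (hy : y = u * surfaceGravity M a Λ (rCosmo M a Λ)) :
    heunEps M a Λ s (I * y) 0 = ((s + 1 - u * bNeg M a Λ : ℝ) : ℂ) := by
  have hκ := (surfaceGravity_rCosmo_pos hsub).ne'
  unfold heunEps
  rw [two_horizonB_rNeg hsub, hy, mul_div_cancel_right₀ _ hκ]
  push_cast
  ring

/-! ### §2. Hatsuda's accessory quantity at `m = 0`, `ω = iy`: affine in `λ`, real data -/

/-- T10's slope `c₁ := 3/(Λ(r₋ − r_n)(r₊ − r_c))` of `λ ↦ heunV(λ)`. -/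
def cSlope (M a Λ : ℝ) : ℝ :=
  3 / (Λ * (rMinus M a Λ - rNeg M a Λ) * (rPlus M a Λ - rCosmo M a Λ))

/-- The (real) intercept `c₀ := heunV(0)` at `m = 0`, `ω = iy`, read off Hatsuda (2.21):
`(1+s)(1+2s)r_n/(r₋−r_n) + [−6s(1−α) + Λ(1+s)(1+2s)r₊(r₊+r_c)]/(Λ(r₋−r_n)(r₊−r_c))`
`+ 6Ξ(1+2s)·y·(r₊r₋ + a²)/(Λ(r₋−r_n)(r₋−r₊)(r₊−r_c))`. -/
def cZero (M a Λ s y : ℝ) : ℝ :=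
  (1 + s) * (1 + 2 * s) * rNeg M a Λ / (rMinus M a Λ - rNeg M a Λ) +
    (-(6 * s * (1 - alpha a Λ)) +
        Λ * (1 + s) * (1 + 2 * s) * rPlus M a Λ * (rPlus M a Λ + rCosmo M a Λ)) /
      (Λ * (rMinus M a Λ - rNeg M a Λ) * (rPlus M a Λ - rCosmo M a Λ)) +
    6 * xi a Λ * (1 + 2 * s) * y * (rPlus M a Λ * rMinus M a Λ + a ^ 2) /
      (Λ * (rMinus M a Λ - rNeg M a Λ) * (rMinus M a Λ - rPlus M a Λ) *
        (rPlus M a Λ - rCosmo M a Λ))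

/-- **`heunV` is affine in `λ` with real data at `m = 0`, `ω = iy`**:
`heunV(λ) = c₁·λ + c₀` (T10 §1: "heunV(λ) = c₀ + c₁λ AFFINE"). -/
theorem heunV_imag (M a Λ s y : ℝ) (lam : ℂ) :
    heunV M a Λ s (I * y) 0 lam = (cSlope M a Λ : ℂ) * lam + (cZero M a Λ s y : ℂ) := by
  unfold heunV cSlope cZero
  push_cast
  linear_combination (-(6 * (xi a Λ : ℂ) * (1 + 2 * (s : ℂ)) * (y : ℂ) *
    ((rPlus M a Λ : ℂ) * (rMinus M a Λ : ℂ) + (a : ℂ) ^ 2) /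
    ((Λ : ℂ) * ((rMinus M a Λ : ℂ) - (rNeg M a Λ : ℂ)) * ((rMinus M a Λ : ℂ) - (rPlus M a Λ : ℂ)) *
      ((rPlus M a Λ : ℂ) - (rCosmo M a Λ : ℂ))))) * I_mul_I

/-- Real part of `heunV(λ)` at `m = 0`, `ω = iy`: `c₁·Re λ + c₀`. -/
theorem re_heunV_imag (M a Λ s y : ℝ) (lam : ℂ) :
    (heunV M a Λ s (I * y) 0 lam).re = cSlope M a Λ * lam.re + cZero M a Λ s y := by
  rw [heunV_imag]
  simp [Complex.add_re, Complex.mul_re, Complex.ofReal_re, Complex.ofReal_im]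

/-- `λ̄ = λ − s(1−α) + Ξ²a²y²` at `m = 0`, `ω = iy` (T10 §1). -/
theorem lambdaBar_imag (a Λ s y : ℝ) (lam : ℂ) :
    lambdaBar a Λ s (I * y) 0 lam =
      lam - ((s * (1 - alpha a Λ) : ℝ) : ℂ) + ((xi a Λ ^ 2 * a ^ 2 * y ^ 2 : ℝ) : ℂ) := by
  unfold lambdaBar
  push_cast
  linear_combination (-((xi a Λ : ℂ) ^ 2 * (a : ℂ) ^ 2 * (y : ℂ) ^ 2)) * I_mul_I

/-- `Re λ̄ = Re λ − s(1−α) + Ξ²a²y²` at `m = 0`, `ω = iy`. -/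
theorem re_lambdaBar_imag (a Λ s y : ℝ) (lam : ℂ) :
    (lambdaBar a Λ s (I * y) 0 lam).re =
      lam.re - s * (1 - alpha a Λ) + xi a Λ ^ 2 * a ^ 2 * y ^ 2 := by
  rw [lambdaBar_imag]
  simp only [Complex.sub_re, Complex.add_re, Complex.ofReal_re]


/-! ### §3. The root functionals `T₁, T₂, T₃` of T10 (3.1) at the tree's roots -/

/-- Elementary positions of the four roots `r_n < 0 ≤ r₋ < r₊ < r_c`, `Λ > 0`, `Ξ > 0`. -/
private theorem roots_facts {M a Λ : ℝ} (hsub : IsSubextremal M a Λ) :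
    0 < Λ ∧ rNeg M a Λ < 0 ∧ 0 ≤ rMinus M a Λ ∧ rMinus M a Λ < rPlus M a Λ ∧
      rPlus M a Λ < rCosmo M a Λ ∧ rNeg M a Λ < rMinus M a Λ ∧ 0 < xi a Λ := by
  have h0 := rMinus_nonneg M a Λ
  obtain ⟨-, hΛ, h01, h12, -⟩ := hsub
  have hX : 0 < xi a Λ := by unfold xi; positivity
  refine ⟨hΛ, ?_, h0, h01, h12, ?_, hX⟩ <;> · unfold rNeg; linarith

/-- `c₁ · T₁ = 1`: the slope of `heunV` is the reciprocal of `T₁ = (Λ/3)(r₋ − r_n)(r₊ − r_c)`. -/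
theorem cSlope_mul_tOne {M a Λ : ℝ} (hsub : IsSubextremal M a Λ) :
    cSlope M a Λ * tOne Λ (rNeg M a Λ) (rMinus M a Λ) (rPlus M a Λ) (rCosmo M a Λ) = 1 := by
  obtain ⟨hΛ, -, -, h01, h12, hnm, -⟩ := roots_facts hsub
  have h1 : rMinus M a Λ - rNeg M a Λ ≠ 0 := by linarith
  have h2 : rPlus M a Λ - rCosmo M a Λ ≠ 0 := by linarith
  unfold cSlope tOne
  field_simp

/-- `c₁ < 0` (T10 §1). -/
theorem cSlope_neg {M a Λ : ℝ} (hsub : IsSubextremal M a Λ) : cSlope M a Λ < 0 := by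
  obtain ⟨hΛ, -, -, h01, h12, hnm, -⟩ := roots_facts hsub
  unfold cSlope
  apply div_neg_of_pos_of_neg (by norm_num)
  have h1 : 0 < Λ * (rMinus M a Λ - rNeg M a Λ) := mul_pos hΛ (by linarith)
  exact mul_neg_of_pos_of_neg h1 (by linarith)

/-- `T₁ < 0` at the tree's roots. -/
theorem tOne_kds_neg {M a Λ : ℝ} (hsub : IsSubextremal M a Λ) :
    tOne Λ (rNeg M a Λ) (rMinus M a Λ) (rPlus M a Λ) (rCosmo M a Λ) < 0 := by
  obtain ⟨hΛ, -, -, h01, h12, hnm, -⟩ := roots_facts hsub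
  unfold tOne
  have h1 : 0 < Λ / 3 * (rMinus M a Λ - rNeg M a Λ) := mul_pos (by positivity) (by linarith)
  exact mul_neg_of_pos_of_neg h1 (by linarith)

/-- `Ξ` of the Vieta file is the tree's `Ξ`: `xiL Λ a² = xi a Λ`. -/
theorem xiL_eq (a Λ : ℝ) : xiL Λ (a ^ 2) = xi a Λ := by unfold xiL xi; ring

/-- `κ₊` of the Vieta file (root-product form) is the tree's surface gravity `κ₊` (CTdC (3.10)). -/
theorem kappaPlus_eq {M a Λ : ℝ} (hsub : IsSubextremal M a Λ) :
    kappaPlus Λ (a ^ 2) (rNeg M a Λ) (rMinus M a Λ) (rPlus M a Λ) (rCosmo M a Λ) =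
      surfaceGravity M a Λ (rPlus M a Λ) := by
  rw [surfaceGravity_rPlus_eq hsub]
  unfold kappaPlus deltaRDerivPlus xiL rNeg xi
  ring

/-- The rewriting behind the `T₃` term of (3.1): `2Ξκ₊(r₊r₋ + a²)/(r₊ − r₋) = T₃` (T10 §3, using
`Δ_r′(r₊) = 2Ξκ₊(r₊² + a²) = (Λ/3)(r₊ − r_n)(r₊ − r₋)(r_c − r₊)`). -/
theorem tThree_eq {M a Λ : ℝ} (hsub : IsSubextremal M a Λ) :
    2 * xi a Λ * surfaceGravity M a Λ (rPlus M a Λ) * (rPlus M a Λ * rMinus M a Λ + a ^ 2) /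
        (rPlus M a Λ - rMinus M a Λ) =
      tThree Λ (a ^ 2) (rNeg M a Λ) (rMinus M a Λ) (rPlus M a Λ) (rCosmo M a Λ) := by
  obtain ⟨hΛ, -, h0, h01, h12, hnm, hX⟩ := roots_facts hsub
  rw [surfaceGravity_rPlus_eq hsub]
  have h1 : rPlus M a Λ - rMinus M a Λ ≠ 0 := by linarith
  have h2 : xi a Λ ≠ 0 := hX.ne'
  have h3 : rPlus M a Λ ^ 2 + a ^ 2 ≠ 0 := by
    have : 0 < rPlus M a Λ := by linarith
    positivity
  unfold tThree rNeg
  field_simp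
  ring

/-- **T10 §2 COROLLARY / (3.1), tree side.** At `m = 0`, `ω = iy`, for EVERY `λ`:
`Re λ̄ = T₁·Re heunV(λ) + s(1−α) − (1+s)(1+2s)·T₂ + (1+2s)·(y/κ₊)·T₃ + Ξ²a²y²`. With
`heunV(λ_k) = q′_k + pγ` and `y = (1+u+d)κ₊` this is `Re λ̄_k = T₁·Re q′_k + Φ`, `Φ` as in (3.1). -/
theorem re_lambdaBar_eq {M a Λ : ℝ} (hsub : IsSubextremal M a Λ) (s y : ℝ) (lam : ℂ) :
    (lambdaBar a Λ s (I * y) 0 lam).re =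
      tOne Λ (rNeg M a Λ) (rMinus M a Λ) (rPlus M a Λ) (rCosmo M a Λ) *
          (heunV M a Λ s (I * y) 0 lam).re +
        (s * (1 - alpha a Λ) -
          (1 + s) * (1 + 2 * s) * tTwo Λ (rNeg M a Λ) (rPlus M a Λ) (rCosmo M a Λ) +
          (1 + 2 * s) * (y / surfaceGravity M a Λ (rPlus M a Λ)) *
            tThree Λ (a ^ 2) (rNeg M a Λ) (rMinus M a Λ) (rPlus M a Λ) (rCosmo M a Λ) +
          xi a Λ ^ 2 * a ^ 2 * y ^ 2) := by
  obtain ⟨hΛ, -, h0, h01, h12, hnm, hX⟩ := roots_facts hsub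
  have hκ := (surfaceGravity_rPlus_pos hsub).ne'
  rw [re_lambdaBar_imag, re_heunV_imag, ← tThree_eq hsub]
  have h1 : rMinus M a Λ - rNeg M a Λ ≠ 0 := by linarith
  have h2 : rPlus M a Λ - rCosmo M a Λ ≠ 0 := by linarith
  have h3 : rMinus M a Λ - rPlus M a Λ ≠ 0 := by linarith
  have h4 : rPlus M a Λ - rMinus M a Λ ≠ 0 := by linarith
  unfold cSlope cZero tOne tTwo
  field_simp
  ring


/-! ### §4. (3.1) → (4.1): the resonance substitution, and the Vieta bundle at the tree's roots -/

/-- **(3.1) becomes (4.1) VERBATIM under the resonance substitution** (T10 §4): with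
`s = ϱu + 1 + i₀`, `p = ub − s`, `γ = 2 + i₀`, `y/κ₊ = ϱu`, `y = u·κ_c`, `κ_c = ϱκ₊` and the Vieta
relation `Σ r_h = 0` (which gives (I1) `T₁ + 2T₂ = (Λ/3)P²`),
`s(1−α) + pγT₁ − (1+s)(1+2s)T₂ + (1+2s)ϱu·T₃ + Ξ²A(uκ_c)² = Φ(u, i₀) = phiDR`. Pure algebra. -/
theorem phi31_eq_phiDR {L A n m p c rho b u i s κp κc : ℝ} (hv : n + m + p + c = 0)
    (hs : s = rho * u + 1 + i) (hκp : κp = kappaPlus L A n m p c) (hκc : κc = rho * κp) :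
    s * (1 - L * A / 3) + (u * b - s) * (2 + i) * tOne L n m p c -
          (1 + s) * (1 + 2 * s) * tTwo L n p c + (1 + 2 * s) * (rho * u) * tThree L A n m p c +
        xiL L A ^ 2 * A * (u * κc) ^ 2 =
      phiDR L A n m p c rho b u i := by
  have I1 : tOne L n m p c + 2 * tTwo L n p c = L / 3 * (p + c) ^ 2 := by
    have hn : n = -(m + p + c) := by linarith
    unfold tOne tTwo; rw [hn]; ring
  subst hs hκc hκp
  unfold phiDR cUU cUI cII cU cI cOne
  linear_combination (-(3 * i) - 2 * rho * u - 2) * I1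

/-- **The tree's roots satisfy the Vieta bundle** of `RouteWDoublyResonantVieta` (for `a ≠ 0`, so
that `r₋ > 0`): `IsOrderedRootData Λ a² M r_n r₋ r₊ r_c`, from the factorisation `delta_eq_prod`. -/
theorem isOrderedRootData_kds {M a Λ : ℝ} (hsub : IsSubextremal M a Λ) (ha : a ≠ 0) :
    IsOrderedRootData Λ (a ^ 2) M (rNeg M a Λ) (rMinus M a Λ) (rPlus M a Λ) (rCosmo M a Λ) := by
  obtain ⟨hΛ, hn, -, h01, h12, -, -⟩ := roots_facts hsub
  refine isOrderedRootData_of_deltaR hn (rMinus_pos hsub ha) h01 h12 hΛ (sq_nonneg a)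
    hsub.1.le fun r => ?_
  have h := delta_eq_prod hsub r
  unfold delta at h
  unfold rNeg
  linear_combination h

/-! ### §5. The conclusion: `Re λ̄ < 0` for every candidate with `Re q′ ≥ 0` -/

/-- ★ **T10's theorem, tree side (modulo the truncation bookkeeping).** On subextremal
Kerr–de Sitter with `a ≠ 0`, at `m = 0`, `ω = iy` on a doubly-resonant stratum — `y = u·κ_c` with
`u > 0` (`u = j − s`) and `y = (s − 1 − i₀)·κ₊` with `i₀ ≥ 0` — every `λ` whose Hatsuda accessory
quantity satisfies `heunV(λ) = q′ + pγ`, `p = u·b_n − s = 1 − ε`, `γ = 2 + i₀`, with `0 ≤ Re q′`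
(Lemma A, `tridiagonal_eigenvalue_re_nonneg`, for the eigenvalues of the truncated recurrence) has
`Re λ̄ < 0`: indeed `Re λ̄ = T₁·Re q′ + Φ` with `T₁ < 0` and `Φ < 0` (Lemma B, `phiDR_neg`). -/
theorem re_lambdaBar_neg_of_re_nonneg {M a Λ : ℝ} (hsub : IsSubextremal M a Λ) (ha : a ≠ 0)
    {s u i₀ y : ℝ} (hu : 0 < u) (hi : 0 ≤ i₀)
    (hyc : y = u * surfaceGravity M a Λ (rCosmo M a Λ))
    (hyp : y = (s - 1 - i₀) * surfaceGravity M a Λ (rPlus M a Λ)) {q : ℂ} (hq : 0 ≤ q.re)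
    {lam : ℂ} (hV : heunV M a Λ s (I * y) 0 lam = q + (((u * bNeg M a Λ - s) * (2 + i₀) : ℝ) : ℂ)) :
    (lambdaBar a Λ s (I * y) 0 lam).re < 0 := by
  have hκp := surfaceGravity_rPlus_pos hsub
  have hκc := surfaceGravity_rCosmo_pos hsub
  have hroot := isOrderedRootData_kds hsub ha
  set κp := surfaceGravity M a Λ (rPlus M a Λ) with hκp_def
  set κc := surfaceGravity M a Λ (rCosmo M a Λ) with hκc_def
  -- the ratio `ϱ = κ_c/κ₊` and the resonance relation `s = ϱu + 1 + i₀`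
  set rho := κc / κp with hrho_def
  have hrho : 0 < rho := div_pos hκc hκp
  have hκc' : κc = rho * κp := by rw [hrho_def, div_mul_cancel₀ _ hκp.ne']
  have hs : s = rho * u + 1 + i₀ := by
    have h : u * κc = (s - 1 - i₀) * κp := by rw [← hyc, ← hyp]
    rw [hκc'] at h
    have h' : (rho * u - (s - 1 - i₀)) * κp = 0 := by linear_combination h
    rcases mul_eq_zero.mp h' with h'' | h''
    · linarith
    · exact absurd h'' hκp.ne'
  have hyk : y / κp = rho * u := by
    rw [hyc, hκc']; field_simp
  -- `Re λ̄ = T₁ Re q′ + Φ₍₃.₁₎`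
  have key := re_lambdaBar_eq hsub s y lam
  have hre : (heunV M a Λ s (I * y) 0 lam).re = q.re + (u * bNeg M a Λ - s) * (2 + i₀) := by
    rw [hV, Complex.add_re, Complex.ofReal_re]
  rw [hre, hyk] at key
  -- `Φ₍₃.₁₎ = phiDR`
  have hphi := phi31_eq_phiDR (b := bNeg M a Λ) hroot.vieta1 hs
    (kappaPlus_eq hsub).symm hκc'
  rw [xiL_eq] at hphi
  have hΦ := phiDR_neg hroot hrho (bNeg_pos hsub) hu hi
  have hT := tOne_kds_neg hsub
  have hα : alpha a Λ = Λ * a ^ 2 / 3 := by unfold alpha; ring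
  rw [key, hα]
  have hyc2 : y = u * κc := hyc
  rw [hyc2]
  nlinarith [mul_nonpos_of_nonpos_of_nonneg hT.le hq]

end Summit.Ventures.KdS.RouteW.DoublyResonant
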